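import Mathlib.Topology.MetricSpace.HolderNorm
import Mathlib.Topology.ContinuousMap.Bounded.Normed
import Mathlib.Analysis.Normed.Group.Basic
import Mathlib.Analysis.Normed.Operator.ContinuousLinearMap
import Literature.Analysis.FunctionSpaces.HolderNorm
import HarnessLib

-- provenance: harness21/H21/H21/Prelude/Sobolev/HolderSpace.lean @ 59c5f06 (interim HEAD d8f2665); M5 mechanical rewrite
/-!
# The Banach space `C^{0,r}_b(X, Y)` of bounded Hölder functions (trunk: Sobolev, concept C9 /
notion `holder_spaces_Ck_alpha`, part 2)

We bundle bounded `r`-Hölder functions `X → Y` into a type `BoundedHolderFunction X Y r`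
carrying the inhomogeneous Hölder norm `‖f‖_{C^{0,r}} = ‖f‖_∞ + [f]_r`
(Gilbarg–Trudinger §4.1, eq. (4.4) with `k = 0`; Evans §5.1), and equip it with the structure of
a real normed space. Completeness (Evans §5.1, Theorem 1: `C^{k,γ}(Ū)` is a Banach space) is
recorded as the named fact `BoundedHolderFunction.completeSpace` (a `Prop`, not an instance, per
CONVENTIONS) and **discharged** at the end of the file (`BoundedHolderFunction.completeSpace_holds`:
a Cauchy sequence converges uniformly, and the Hölder control of its tail passes to the limit).

## Mathlib

Mathlib has the bundled sup-normed space `X →ᵇ Y` (`BoundedContinuousFunction`), the Hölder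
seminorm `eHolderNorm`/`nnHolderNorm` and the predicate `MemHolder` with `MemHolder.add`,
`MemHolder.smul`, `MemHolder.nnHolderNorm_add_le`, `MemHolder.nnHolderNorm_smul`
(`Mathlib.Topology.MetricSpace.HolderNorm`), and the constructors
`AddGroupNorm.toNormedAddCommGroup`, `Function.Injective.addCommGroup/module`. It has no
bundled Hölder space (searched: `HolderSpace`, `HolderFunction`, `BoundedHolder`); we build one
on top of `X →ᵇ Y`.

## Design choices

* `structure BoundedHolderFunction (X Y) (r) extends X →ᵇ Y` with the extra field
  `MemHolder r toFun`. `[MetricSpace X]` (not pseudo-(e)metric): Mathlib's algebra of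
  `MemHolder`/`nnHolderNorm` is stated there; `Y` is a real normed space.
* Only `k = 0` is bundled in v0; `C^{k,α}` for `k ≥ 1` stays the predicate
  `Literature.Analysis.FunctionSpaces.MemContDiffHolder` (`HolderNorm.lean`).
* The norm is `‖f.toBoundedContinuousFunction‖ + nnHolderNorm r f` (real-valued); the
  `NormedAddCommGroup` structure comes from an `AddGroupNorm` with genuine proofs, so the metric
  is the norm metric (not the sup metric inherited from `X →ᵇ Y`).
* Continuity is part of the data (from `X →ᵇ Y`); for `0 < r` it follows from the Hölder
  condition, but for `r = 0` it does not, so `ofMemBoundedHolder` takes it as a hypothesis.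

## References

* D. Gilbarg, N. Trudinger, *Elliptic PDE of second order* (2001), §4.1.
* L. C. Evans, *Partial Differential Equations* (2nd ed., 2010), §5.1, Theorem 1.
-/

open Set Topology BoundedContinuousFunction
open scoped NNReal ENNReal

noncomputable section

namespace Literature.Analysis.FunctionSpaces

/-- The space `C^{0,r}_b(X, Y)` of bounded continuous `r`-Hölder functions `X → Y`: bounded
continuous functions with finite Hölder seminorm `[f]_r < ∞` (Gilbarg–Trudinger §4.1;
Evans §5.1). [folklore] -/
structure BoundedHolderFunction (X Y : Type*) [MetricSpace X] [NormedAddCommGroup Y]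
    [NormedSpace ℝ Y] (r : ℝ≥0) extends X →ᵇ Y where
  /-- The underlying function is `r`-Hölder. -/
  memHolder' : MemHolder r toFun

namespace BoundedHolderFunction

variable {X Y : Type*} [MetricSpace X] [NormedAddCommGroup Y] [NormedSpace ℝ Y] {r : ℝ≥0}

/-- `C^{0,r}_b(X, Y)` is a type of functions `X → Y`. [folklore] -/
instance instFunLike : FunLike (BoundedHolderFunction X Y r) X Y where
  coe f := f.toFun
  coe_injective f g h := by
    cases f; cases g; congr; exact DFunLike.coe_injective h

/-- The coercion of the underlying bounded continuous function agrees with the coercion. [folklore] -/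
@[simp]
theorem coe_toBoundedContinuousFunction (f : BoundedHolderFunction X Y r) :
    (f.toBoundedContinuousFunction : X → Y) = f := rfl

/-- Extensionality for `C^{0,r}_b(X, Y)`. [folklore] -/
@[ext]
theorem ext {f g : BoundedHolderFunction X Y r} (h : ∀ x, f x = g x) : f = g :=
  DFunLike.ext f g h

/-- The map to bounded continuous functions is injective. [folklore] -/
theorem toBoundedContinuousFunction_injective :
    Function.Injective
      (toBoundedContinuousFunction : BoundedHolderFunction X Y r → X →ᵇ Y) :=
  fun f g h => ext fun x => by rw [← coe_toBoundedContinuousFunction, h]; rfl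

/-- Elements of `C^{0,r}_b(X, Y)` are `r`-Hölder (Gilbarg–Trudinger §4.1). [folklore] -/
theorem memHolder (f : BoundedHolderFunction X Y r) : MemHolder r (f : X → Y) := f.memHolder'

/-- Elements of `C^{0,r}_b(X, Y)` are continuous. [folklore] -/
theorem continuous (f : BoundedHolderFunction X Y r) : Continuous (f : X → Y) :=
  f.toBoundedContinuousFunction.continuous

/-- Elements of `C^{0,r}_b(X, Y)` lie in the class `MemBoundedHolder r` of `HolderNorm.lean`
(bounded with finite Hölder seminorm). [folklore] -/
theorem memBoundedHolder (f : BoundedHolderFunction X Y r) : MemBoundedHolder r (f : X → Y) := by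
  refine memBoundedHolder_iff.2 ⟨?_, f.memHolder⟩
  exact ⟨‖f.toBoundedContinuousFunction‖,
    fun x => f.toBoundedContinuousFunction.norm_coe_le_norm x⟩

/-- Build an element of `C^{0,r}_b(X, Y)` from a continuous function in the class
`MemBoundedHolder r` (Gilbarg–Trudinger §4.1). Continuity is automatic for `0 < r`
(`MemBoundedHolder.continuous`) but not for `r = 0`, hence the hypothesis. [folklore] -/
def ofMemBoundedHolder (f : X → Y) (hf : MemBoundedHolder r f) (hcont : Continuous f) :
    BoundedHolderFunction X Y r where
  toBoundedContinuousFunction :=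
    BoundedContinuousFunction.ofNormedAddCommGroup f hcont
      (Classical.choose (memBoundedHolder_iff.1 hf).1)
      (Classical.choose_spec (memBoundedHolder_iff.1 hf).1)
  memHolder' := hf.memHolder

/-- The underlying function of `ofMemBoundedHolder f _ _` is `f`. [folklore] -/
@[simp]
theorem coe_ofMemBoundedHolder (f : X → Y) (hf : MemBoundedHolder r f) (hcont : Continuous f) :
    (ofMemBoundedHolder f hf hcont : X → Y) = f := rfl

/-! ### Algebraic structure -/

/-- `MemHolder` is invariant under negation (not in Mathlib in this form). [folklore] -/
theorem _root_.MemHolder.neg' {f : X → Y} (hf : MemHolder r f) : MemHolder r (-f) := by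
  simpa using hf.smul (c := (-1 : ℝ))

/-- The zero function of `C^{0,r}_b(X, Y)`. [folklore] -/
instance instZero : Zero (BoundedHolderFunction X Y r) :=
  ⟨⟨0, (memHolder_zero : MemHolder r (0 : X → Y))⟩⟩

/-- Pointwise addition on `C^{0,r}_b(X, Y)` (closure: Mathlib `MemHolder.add`). [folklore] -/
instance instAdd : Add (BoundedHolderFunction X Y r) :=
  ⟨fun f g => ⟨f.toBoundedContinuousFunction + g.toBoundedContinuousFunction,
    f.memHolder.add g.memHolder⟩⟩

/-- Pointwise negation on `C^{0,r}_b(X, Y)`. [folklore] -/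
instance instNeg : Neg (BoundedHolderFunction X Y r) :=
  ⟨fun f => ⟨-f.toBoundedContinuousFunction, f.memHolder.neg'⟩⟩

/-- Pointwise subtraction on `C^{0,r}_b(X, Y)`. [folklore] -/
instance instSub : Sub (BoundedHolderFunction X Y r) :=
  ⟨fun f g => ⟨f.toBoundedContinuousFunction - g.toBoundedContinuousFunction, by
    simpa [sub_eq_add_neg] using f.memHolder.add g.memHolder.neg'⟩⟩

/-- Real scalar multiplication on `C^{0,r}_b(X, Y)` (closure: Mathlib `MemHolder.smul`). [folklore] -/
instance instSMul : SMul ℝ (BoundedHolderFunction X Y r) :=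
  ⟨fun c f => ⟨c • f.toBoundedContinuousFunction, f.memHolder.smul (c := c)⟩⟩

/-- Natural scalar multiplication on `C^{0,r}_b(X, Y)` (closure: Mathlib `MemHolder.nsmul`). [folklore] -/
instance instNSMul : SMul ℕ (BoundedHolderFunction X Y r) :=
  ⟨fun n f => ⟨n • f.toBoundedContinuousFunction, f.memHolder.nsmul n⟩⟩

/-- Integer scalar multiplication on `C^{0,r}_b(X, Y)`. [folklore] -/
instance instZSMul : SMul ℤ (BoundedHolderFunction X Y r) :=
  ⟨fun n f => ⟨n • f.toBoundedContinuousFunction, by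
    have h := f.memHolder.smul (c := (n : ℝ))
    simpa [Int.cast_smul_eq_zsmul] using h⟩⟩

/-- The projection to `X →ᵇ Y` sends `0` to `0`. [folklore] -/
@[simp] theorem toBoundedContinuousFunction_zero :
    (0 : BoundedHolderFunction X Y r).toBoundedContinuousFunction = 0 := rfl

/-- The projection to `X →ᵇ Y` is additive. [folklore] -/
@[simp] theorem toBoundedContinuousFunction_add (f g : BoundedHolderFunction X Y r) :
    (f + g).toBoundedContinuousFunction =
      f.toBoundedContinuousFunction + g.toBoundedContinuousFunction := rfl

/-- The projection to `X →ᵇ Y` commutes with negation. [folklore] -/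
@[simp] theorem toBoundedContinuousFunction_neg (f : BoundedHolderFunction X Y r) :
    (-f).toBoundedContinuousFunction = -f.toBoundedContinuousFunction := rfl

/-- The projection to `X →ᵇ Y` commutes with subtraction. [folklore] -/
@[simp] theorem toBoundedContinuousFunction_sub (f g : BoundedHolderFunction X Y r) :
    (f - g).toBoundedContinuousFunction =
      f.toBoundedContinuousFunction - g.toBoundedContinuousFunction := rfl

/-- The projection to `X →ᵇ Y` commutes with real scalar multiplication. [folklore] -/
@[simp] theorem toBoundedContinuousFunction_smul (c : ℝ) (f : BoundedHolderFunction X Y r) :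
    (c • f).toBoundedContinuousFunction = c • f.toBoundedContinuousFunction := rfl

/-- The zero element is the zero function. [folklore] -/
@[simp] theorem coe_zero : ((0 : BoundedHolderFunction X Y r) : X → Y) = 0 := rfl

/-- Addition is pointwise. [folklore] -/
@[simp] theorem coe_add (f g : BoundedHolderFunction X Y r) : ⇑(f + g) = f + g := rfl

/-- Negation is pointwise. [folklore] -/
@[simp] theorem coe_neg (f : BoundedHolderFunction X Y r) : ⇑(-f) = -f := rfl

/-- Subtraction is pointwise. [folklore] -/
@[simp] theorem coe_sub (f g : BoundedHolderFunction X Y r) : ⇑(f - g) = f - g := rfl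

/-- Real scalar multiplication is pointwise. [folklore] -/
@[simp] theorem coe_smul (c : ℝ) (f : BoundedHolderFunction X Y r) : ⇑(c • f) = c • f := rfl

/-- `C^{0,r}_b(X, Y)` is an additive commutative group, pulled back along the injection into
`X →ᵇ Y`. [folklore] -/
instance instAddCommGroup : AddCommGroup (BoundedHolderFunction X Y r) :=
  toBoundedContinuousFunction_injective.addCommGroup _ rfl (fun _ _ => rfl) (fun _ => rfl)
    (fun _ _ => rfl) (fun _ _ => rfl) (fun _ _ => rfl)

/-- The injection `C^{0,r}_b(X, Y) → (X →ᵇ Y)` as an additive monoid homomorphism. [folklore] -/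
def toBoundedContinuousFunctionAddHom : BoundedHolderFunction X Y r →+ (X →ᵇ Y) where
  toFun := toBoundedContinuousFunction
  map_zero' := rfl
  map_add' _ _ := rfl

/-- `C^{0,r}_b(X, Y)` is a real vector space, pulled back along the injection into `X →ᵇ Y`. [folklore] -/
instance instModule : Module ℝ (BoundedHolderFunction X Y r) :=
  toBoundedContinuousFunction_injective.module ℝ toBoundedContinuousFunctionAddHom fun _ _ => rfl

/-! ### Norm -/

/-- The inhomogeneous Hölder norm `‖f‖_{C^{0,r}} = ‖f‖_∞ + [f]_r` on `C^{0,r}_b(X, Y)`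
(Gilbarg–Trudinger §4.1, eq. (4.4), `k = 0`; Evans §5.1). [folklore] -/
instance instNorm : Norm (BoundedHolderFunction X Y r) :=
  ⟨fun f => ‖f.toBoundedContinuousFunction‖ + nnHolderNorm r (f : X → Y)⟩

/-- Unfolding the norm of `C^{0,r}_b(X, Y)`. [folklore] -/
theorem norm_def (f : BoundedHolderFunction X Y r) :
    ‖f‖ = ‖f.toBoundedContinuousFunction‖ + nnHolderNorm r (f : X → Y) := rfl

/-- The sup norm is bounded by the Hölder norm. [folklore] -/
theorem norm_toBoundedContinuousFunction_le (f : BoundedHolderFunction X Y r) :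
    ‖f.toBoundedContinuousFunction‖ ≤ ‖f‖ :=
  le_add_of_nonneg_right (nnHolderNorm r (f : X → Y)).coe_nonneg

/-- The Hölder seminorm is bounded by the Hölder norm. [folklore] -/
theorem nnHolderNorm_le_norm (f : BoundedHolderFunction X Y r) :
    (nnHolderNorm r (f : X → Y) : ℝ) ≤ ‖f‖ :=
  le_add_of_nonneg_left (norm_nonneg _)

/-- Pointwise values are bounded by the Hölder norm. [folklore] -/
theorem norm_apply_le_norm (f : BoundedHolderFunction X Y r) (x : X) : ‖f x‖ ≤ ‖f‖ :=
  (f.toBoundedContinuousFunction.norm_coe_le_norm x).trans f.norm_toBoundedContinuousFunction_le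

/-- The Hölder norm of `-f` is that of `f`. [folklore] -/
theorem norm_neg' (f : BoundedHolderFunction X Y r) : ‖-f‖ = ‖f‖ := by
  rw [norm_def, norm_def, toBoundedContinuousFunction_neg, norm_neg, coe_neg]
  congr 2
  simpa using f.memHolder.nnHolderNorm_smul (-1 : ℝ)

/-- Triangle inequality for the Hölder norm (from `norm_add_le` on `X →ᵇ Y` and Mathlib's
`MemHolder.nnHolderNorm_add_le`). [folklore] -/
theorem norm_add_le' (f g : BoundedHolderFunction X Y r) : ‖f + g‖ ≤ ‖f‖ + ‖g‖ := by
  rw [norm_def, norm_def, norm_def, toBoundedContinuousFunction_add, coe_add]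
  have h₁ := norm_add_le f.toBoundedContinuousFunction g.toBoundedContinuousFunction
  have h₂ : (nnHolderNorm r (⇑f + ⇑g) : ℝ) ≤ nnHolderNorm r (f : X → Y) + nnHolderNorm r ⇑g := by
    exact_mod_cast f.memHolder.nnHolderNorm_add_le g.memHolder
  linarith

/-- Definiteness: only `0` has Hölder norm `0` (from the sup-norm part). [folklore] -/
theorem eq_zero_of_norm_eq_zero {f : BoundedHolderFunction X Y r} (h : ‖f‖ = 0) : f = 0 := by
  have h0 : ‖f.toBoundedContinuousFunction‖ = 0 :=
    le_antisymm (f.norm_toBoundedContinuousFunction_le.trans h.le) (norm_nonneg _)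
  exact toBoundedContinuousFunction_injective (norm_eq_zero.1 h0)

/-- The Hölder norm as an `AddGroupNorm`. [folklore] -/
def addGroupNorm : AddGroupNorm (BoundedHolderFunction X Y r) where
  toFun f := ‖f‖
  map_zero' := by simp [norm_def]
  add_le' := norm_add_le'
  neg' := norm_neg'
  eq_zero_of_map_eq_zero' _ := eq_zero_of_norm_eq_zero

/-- `C^{0,r}_b(X, Y)` is a normed additive commutative group for the Hölder norm
(Gilbarg–Trudinger §4.1). [folklore] -/
instance instNormedAddCommGroup : NormedAddCommGroup (BoundedHolderFunction X Y r) :=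
  { AddGroupNorm.toNormedAddCommGroup addGroupNorm with
    norm := fun f => ‖f‖
    dist := fun f g => ‖-f + g‖ }

/-- Homogeneity of the Hölder norm (from Mathlib's `MemHolder.nnHolderNorm_smul`). [folklore] -/
theorem norm_smul' (c : ℝ) (f : BoundedHolderFunction X Y r) : ‖c • f‖ = ‖c‖ * ‖f‖ := by
  rw [norm_def, norm_def, toBoundedContinuousFunction_smul, norm_smul, coe_smul,
    f.memHolder.nnHolderNorm_smul c, NNReal.coe_mul, coe_nnnorm, mul_add]

/-- `C^{0,r}_b(X, Y)` is a real normed space (Gilbarg–Trudinger §4.1). [folklore] -/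
instance instNormedSpace : NormedSpace ℝ (BoundedHolderFunction X Y r) where
  norm_smul_le c f := (norm_smul' c f).le

/-- The norm of `f ∈ C^{0,r}_b(X, Y)` is the real inhomogeneous Hölder norm
`boundedHolderNorm r f = (eSupNorm f + eHolderNorm r f).toReal` of `HolderNorm.lean`
(the sup norm of `X →ᵇ Y` is `sup_x ‖f x‖`, and `nnHolderNorm = eHolderNorm` on `MemHolder`). [cite: GilbargTrudinger2001, §4.1 (the inhomogeneous Hölder norm (4.6)); definitional bridge, pending proof] -/
def norm_eq_boundedHolderNorm : Prop :=
  ∀ (f : BoundedHolderFunction X Y r),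
    ‖f‖ = boundedHolderNorm r (f : X → Y)

/-- The norm of `ofMemBoundedHolder f` is the real inhomogeneous Hölder norm
`boundedHolderNorm r f` of `HolderNorm.lean`. [folklore] -/
def norm_ofMemBoundedHolder_eq_boundedHolderNorm : Prop :=
  ∀ (f : X → Y) (hf : MemBoundedHolder r f) (hcont : Continuous f),
    ‖ofMemBoundedHolder f hf hcont‖ = boundedHolderNorm r f

/- interim proof relied on results that are now named facts (D-0014); demoted to a fact by the M5 import, proof preserved:
:=
  norm_eq_boundedHolderNorm _
-/

/-- The injection `C^{0,r}_b(X, Y) → (X →ᵇ Y)` as a continuous linear map (norm `≤ 1`). [folklore] -/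
def toBoundedContinuousFunctionCLM : BoundedHolderFunction X Y r →L[ℝ] (X →ᵇ Y) :=
  LinearMap.mkContinuous
    { toFun := toBoundedContinuousFunction
      map_add' := fun _ _ => rfl
      map_smul' := fun _ _ => rfl } 1
    fun f => by simpa using f.norm_toBoundedContinuousFunction_le

/-- `toBoundedContinuousFunctionCLM` is the structure projection. [folklore] -/
@[simp]
theorem toBoundedContinuousFunctionCLM_apply (f : BoundedHolderFunction X Y r) :
    toBoundedContinuousFunctionCLM f = f.toBoundedContinuousFunction := rfl

/-- `C^{0,r}_b(X, Y)` is a Banach space for a complete target `Y` (Evans §5.1, Theorem 1;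
Gilbarg–Trudinger §4.1). Stated as a theorem, not an instance, until proved. [cite: Evans2010, §5.1 Theorem 1] [cite: GilbargTrudinger2001, §4.1] -/
def completeSpace : Prop :=
  ∀ [CompleteSpace Y],
    CompleteSpace (BoundedHolderFunction X Y r)

/-! ### Discharge of the norm bridge (Gilbarg–Trudinger §4.1, eq. (4.6) with `k = 0`) -/

/-- The sup norm of the underlying bounded continuous function, read in `ℝ≥0∞`, is the extended
sup norm `eSupNorm f = ⨆ x, ‖f x‖ₑ` of `HolderNorm.lean` (both are `|u|_{0;Ω} = sup_Ω |u|`,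
Gilbarg–Trudinger §4.1, eq. (4.5) with `k = 0`; on an empty domain both sides are `0`). [folklore] -/
theorem eSupNorm_eq_ofReal_norm (f : BoundedHolderFunction X Y r) :
    eSupNorm (f : X → Y) = ENNReal.ofReal ‖f.toBoundedContinuousFunction‖ := by
  refine le_antisymm (iSup_le fun x => ?_) ?_
  · rw [← ofReal_norm]
    exact ENNReal.ofReal_le_ofReal (f.toBoundedContinuousFunction.norm_coe_le_norm x)
  · have hfin : eSupNorm (f : X → Y) < ∞ := f.memBoundedHolder.eSupNorm_lt_top
    rw [← ENNReal.ofReal_toReal hfin.ne]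
    refine ENNReal.ofReal_le_ofReal ?_
    refine (BoundedContinuousFunction.norm_le ENNReal.toReal_nonneg).2 fun x => ?_
    have hx : ‖(f : X → Y) x‖ₑ ≤ eSupNorm (f : X → Y) := enorm_le_eSupNorm _ x
    have := ENNReal.toReal_mono hfin.ne hx
    simpa using this

/-- Discharge of the named fact `norm_eq_boundedHolderNorm`: the bundled norm
`‖f‖ = ‖f‖_∞ + [f]_r` of `C^{0,r}_b(X, Y)` equals the real inhomogeneous Hölder norm
`boundedHolderNorm r f = (eSupNorm f + eHolderNorm r f).toReal`. Both are Lean renderings of the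
same printed definition `‖u‖_{C^{0,α}(Ω̄)} = |u|_{0;Ω} + [u]_{α;Ω}`; the proof identifies the
sup parts (`eSupNorm_eq_ofReal_norm`) and the Hölder parts (Mathlib
`MemHolder.coe_nnHolderNorm_eq_eHolderNorm`), then splits `toReal` over the finite sum.
[cite: GilbargTrudinger2001, §4.1, eq. (4.6) with k = 0] -/
theorem norm_eq_boundedHolderNorm_holds :
    norm_eq_boundedHolderNorm (X := X) (Y := Y) (r := r) := by
  intro f
  rw [norm_def, boundedHolderNorm, eBoundedHolderNorm_def, eSupNorm_eq_ofReal_norm,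
    ← f.memHolder.coe_nnHolderNorm_eq_eHolderNorm,
    ENNReal.toReal_add ENNReal.ofReal_ne_top ENNReal.coe_ne_top,
    ENNReal.toReal_ofReal (norm_nonneg _), ENNReal.coe_toReal]

/-- Discharge of the named fact `norm_ofMemBoundedHolder_eq_boundedHolderNorm` (the interim proof,
restored): specialise `norm_eq_boundedHolderNorm_holds` to `ofMemBoundedHolder f hf hcont`, whose
underlying function is `f` by `rfl`. [cite: GilbargTrudinger2001, §4.1, eq. (4.6) with k = 0] -/
theorem norm_ofMemBoundedHolder_eq_boundedHolderNorm_holds :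
    norm_ofMemBoundedHolder_eq_boundedHolderNorm (X := X) (Y := Y) (r := r) :=
  fun f hf hcont => norm_eq_boundedHolderNorm_holds (ofMemBoundedHolder f hf hcont)

/-! ### Discharge of completeness (Evans §5.1, Theorem 1) -/

open Filter

/-- Pointwise convergence of the values along a sequence converging in `X →ᵇ Y`
(evaluation is continuous). [folklore] -/
theorem tendsto_apply_of_tendsto_toBoundedContinuousFunction {u : ℕ → BoundedHolderFunction X Y r}
    {g : X →ᵇ Y} (hg : Tendsto (fun n => (u n).toBoundedContinuousFunction) atTop (𝓝 g)) (x : X) :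
    Tendsto (fun n => u n x) atTop (𝓝 (g x)) := by
  have := ((continuous_eval_const (F := X →ᵇ Y) x).tendsto g).comp hg
  simpa [Function.comp_def] using this

/-- **Hölder control of the tail of a Cauchy sequence** (the key step of Evans §5.1, Theorem 1):
if `u` is Cauchy in `C^{0,r}_b(X, Y)` and its values converge pointwise to `g`, then for every
`ε > 0` eventually `u n − g` is `ε`-Hölder — pass to the limit `m → ∞` in
`‖(u n − u m)(x) − (u n − u m)(y)‖ ≤ [u n − u m]_r d(x,y)^r ≤ ε d(x,y)^r`. [folklore] -/
theorem eventually_holderWith_sub_of_cauchySeq {u : ℕ → BoundedHolderFunction X Y r}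
    (hu : CauchySeq u) {g : X → Y} (hpt : ∀ x, Tendsto (fun n => u n x) atTop (𝓝 (g x)))
    {ε : ℝ≥0} (hε : 0 < ε) : ∃ N, ∀ n ≥ N, HolderWith ε r (fun x => u n x - g x) := by
  obtain ⟨N, hN⟩ := Metric.cauchySeq_iff.1 hu ε (by exact_mod_cast hε)
  refine ⟨N, fun n hn x y => ?_⟩
  have hm : ∀ m ≥ N,
      edist (u n x - u m x) (u n y - u m y) ≤ (ε : ℝ≥0∞) * edist x y ^ (r : ℝ) := by
    intro m hm
    have hd : ‖u n - u m‖ < ε := by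
      rw [← dist_eq_norm]
      exact hN n hn m hm
    have hH : HolderWith (nnHolderNorm r ⇑(u n - u m)) r ⇑(u n - u m) :=
      (u n - u m).memHolder.holderWith
    have hle : nnHolderNorm r ⇑(u n - u m) ≤ ε := by
      have h1 := (u n - u m).nnHolderNorm_le_norm
      exact_mod_cast h1.trans hd.le
    have hle' : ((nnHolderNorm r ⇑(u n - u m) : ℝ≥0) : ℝ≥0∞) ≤ (ε : ℝ≥0∞) :=
      ENNReal.coe_le_coe.2 hle
    have hxy := hH x y
    simp only [coe_sub, Pi.sub_apply] at hxy
    exact hxy.trans (mul_le_mul' hle' le_rfl)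
  have hlim : Tendsto (fun m => edist (u n x - u m x) (u n y - u m y)) atTop
      (𝓝 (edist (u n x - g x) (u n y - g y))) :=
    (tendsto_const_nhds.sub (hpt x)).edist (tendsto_const_nhds.sub (hpt y))
  exact le_of_tendsto hlim (eventually_atTop.2 ⟨N, hm⟩)

/-- **Discharge of the named fact `completeSpace`: `C^{0,r}_b(X, Y)` is a Banach space for
complete `Y`** (Evans §5.1, Theorem 1; Gilbarg–Trudinger §4.1). Proof: a Cauchy sequence `u` is
Cauchy in `X →ᵇ Y` (the projection has norm `≤ 1`), hence converges uniformly to some `g`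
(Mathlib: `X →ᵇ Y` is complete); by `eventually_holderWith_sub_of_cauchySeq` the differences
`u n − g` are eventually `ε`-Hölder for every `ε > 0`, so `g` is `r`-Hölder and
`‖u n − g‖_{C^{0,r}} = ‖u n − g‖_∞ + [u n − g]_r → 0`. [cite: Evans2010, §5.1 Theorem 1] -/
theorem completeSpace_holds : completeSpace (X := X) (Y := Y) (r := r) := by
  intro _
  refine Metric.complete_of_cauchySeq_tendsto fun u hu => ?_
  -- the underlying bounded continuous functions converge uniformly
  have hu' : CauchySeq fun n => (u n).toBoundedContinuousFunction :=
    (toBoundedContinuousFunctionCLM (X := X) (Y := Y) (r := r)).uniformContinuous.comp_cauchySeq hu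
  obtain ⟨g, hg⟩ := cauchySeq_tendsto_of_complete hu'
  have hpt : ∀ x, Tendsto (fun n => u n x) atTop (𝓝 (g x)) :=
    tendsto_apply_of_tendsto_toBoundedContinuousFunction hg
  -- the limit is Hölder
  obtain ⟨N₁, hN₁⟩ := eventually_holderWith_sub_of_cauchySeq hu hpt one_pos
  have hgH : MemHolder r (g : X → Y) := by
    have h1 : MemHolder r (fun x => u N₁ x - g x) := (hN₁ N₁ le_rfl).memHolder
    have h2 : MemHolder r ((u N₁ : X → Y) + -(fun x => u N₁ x - g x)) := (u N₁).memHolder.add h1.neg'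
    convert h2 using 1
    funext x
    simp
  set G : BoundedHolderFunction X Y r := ⟨g, hgH⟩ with hG
  have hGg : ∀ x, G x = g x := fun _ => rfl
  refine ⟨G, Metric.tendsto_atTop.2 fun ε hε => ?_⟩
  -- sup part and Hölder part of `‖u n - G‖` are eventually `< ε/2` resp. `≤ ε/4`
  set ε' : ℝ≥0 := ⟨ε / 4, by positivity⟩ with hε'
  have hε'pos : 0 < ε' := by
    rw [hε', ← NNReal.coe_pos]
    show 0 < ε / 4
    positivity
  obtain ⟨N₂, hN₂⟩ := eventually_holderWith_sub_of_cauchySeq hu hpt hε'pos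
  obtain ⟨N₃, hN₃⟩ := Metric.tendsto_atTop.1 hg (ε / 2) (half_pos hε)
  refine ⟨max N₂ N₃, fun n hn => ?_⟩
  rw [dist_eq_norm, norm_def, toBoundedContinuousFunction_sub]
  have h1 : ‖(u n).toBoundedContinuousFunction - G.toBoundedContinuousFunction‖ < ε / 2 := by
    rw [← dist_eq_norm]
    exact hN₃ n (le_of_max_le_right hn)
  have h2 : (nnHolderNorm r ⇑(u n - G) : ℝ) ≤ ε / 4 := by
    have hH : HolderWith ε' r ⇑(u n - G) := hN₂ n (le_of_max_le_left hn)
    have := hH.nnholderNorm_le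
    have h' : ((nnHolderNorm r ⇑(u n - G) : ℝ≥0) : ℝ) ≤ (ε' : ℝ) := by exact_mod_cast this
    exact h'
  linarith

end BoundedHolderFunction

end Literature.Analysis.FunctionSpaces
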